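import Summits.Ventures.HSemireg.TwoAdicReadings

/-!
# The leading digits of the edge unit: LEMMA D(a)'s twelve kills with remainder, and LEMMA A(a)'s chain (pub-hsemireg, S4-PUSH corner 2)

Companion of `TwoAdicReadings.lean` (seat s4-search-2 gen 15, cell `pub-hsemireg`; memo
`s4push/search-2/g11/LIFT2-search-2-g11.md` §2 ∕ §5, the (2,2,3,3,3,3) edge unit of the M2 decision — 83 classes).
Of record: of the 28 non-degenerate leading digits `C = β₀₁h₀ + β₂₃h₁ + N` on `V₀₁` (edge `Ω̄ = h̄₀h̄₁`), twelve
die by (V) at depth 1 with `(k, v, g) = (3, 7, 8)`; `DegreeSixSecondDigit.T3_leading_edge` is the IDENTITY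
`T₃(C) = −2⁷σ₂(β₀₁ + β₂₃)·H₂S₁ + 2⁸·(explicit)` (kernel); the READING «`v₂ = 7 < 8` iff `β₀₁ + β₂₃` odd, no
remainder repairs it» was pencil ∕ machine.  Here: the registered `T₃` at `C + 2Z` for ANY even remainder `Z`
(divided powers `E₂ = C₂ + 2CZ + 4Z₂`, `E₃ = C₃ + 2C₂Z + 4CZ₂ + 8Z₃`, the device of `DegreeSixSecondDigit.lemmaB`)
equals `−2⁷σ₂(β₀₁ + β₂₃)·H₂S₁ + 2⁸·(explicit)` on the frame (`T3Z_leading_edge_frame`; the remainder terms are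
divisible by `2⁸` because the digit is NON-DEGENERATE: `C^[2] = (β₀₁β₂₃ + ν)h₀h₁` with odd Pfaffian `2p + 1`, so
`K₃,₁(C) = −4σ₂D^[2] − 64σ₀C^[2] ≡ −64(σ₂ + σ₀(2p+1))h₀h₁ ≡ 0 mod 2⁷`), and — in `ExteriorAlgebra ℤ M` for ANY free
`ℤ`-module with a basis `x : Fin 12`, cross-line part `N = n₁l₁ + ⋯ + n₄l₄`, all parameters ANY even elements —
`lemmaD_a_reading`: if `β₀₁ + β₂₃ = 2r + 1` then `T₃(C + 2Z) ≠ 256·Z'` for every `Z'`: CRITERION L fails at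
`k = 3` for every completion of such a leading digit (the functional `Φ = τ ∘ Λ(π)` of `TwoAdicReadings`:
`Φ(H₂S₁) = 1`, and `σ₂(2r+1) = (4t − 2s − 1)(2r + 1)` has odd coefficient sum).

§2 (the other fifteen (V)-surviving digits, LEMMA A(a)'s inconsistent direction AS A CHAIN): `natCast_mul_cancel`
— `Λ^•M` is torsion-free (`n·Q = n·Q' ⇒ Q = Q'`, through the integer coordinates of Mathlib's `Basis.ExteriorAlgebra`;
the memo's item (β) «the torsion-free iff») — and `lemmaA_a_chain`: for a non-degenerate leading digit `C` with a
cross-line functional `F` of EVEN pairing (`β₂₃ + ϖ = 2m`), ANY first digit `X` and remainder `Y`, the `k = 2`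
criterion `T₂(C + 2X + 4Y) = 64·Z` (`Z` even) is `False`: `DegreeSixSecondDigit.T2_leading` in the commutative ring
`Λ` (`T₂ = 32·(pH₂ − HS₁ + CX) + 64·W₁`), then (β) gives the digit equation `pH₂ − HS₁ + CX = 2·(Z − W₁)`, then
`TwoAdicReadings.lemmaA_a_reading` (obstruction + top-class reading) refutes it.  And for the sixteenth digit `C̄ = H̄`:
`edge_digit_equation` — the `k = 2` criterion `T₂(H + 2X + 4Y) = 64·Z` yields `(ι x₀ ι x₁ + ι x₂ ι x₃)·(X − S₁) = 2·W`
(`W` even), the hypothesis of `DigitSpaceClause.digitSpace_clause`, whose parities re-parametrise `X` as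
`S₁ + L + ηH + 2E'` for `TwoAdicReadings.lemmaB_reading`.

Honest framing as in the companions: theorems only (count-neutral); the identities for any commutative ring, the
readings over `ℤ`; which twelve of the 28 digits have `β₀₁ + β₂₃` odd, that an even-pairing `F` exists for the
other fifteen (the two-line case split in `T2_leading`'s docstring), and the list of 28, stay with the memo's
enumeration; a kernel check of a CLASS-LEVEL necessary-condition sieve (CRITERION L) at the special fibre `E⁶`;
no object, no `σ` computation, no Hodge statement; nothing here bears on HC ∕ HC_CM ∕ HC_AV.
-/

namespace Summit.Ventures.HSemireg.LeadingDigitRemainder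

open ExteriorAlgebra TwoAdicReadings TwoSlotFrameTable DegreeSixSecondDigit
open scoped IsMulCommutative

/-- **LEMMA D(a) at `C + 2Z` on the frame (any commutative ring).**  Leading digit `C = β₀₁h₀ + β₂₃h₁ + N`
(`h₀N = h₁N = 0`, `N^[2] = N₂ = ν·h₀h₁`), NON-DEGENERATE: `β₀₁β₂₃ + ν = 2p + 1`; closed forms `C₂, C₃` of
`C^[2], C^[3]` (`sq_C`, `cube_C`), `D, D₂, D₃` of the edge type; σ-parametrisation `σ₁ = 0`, `σ₀ = 2s + 1`,
`σ₂ = 4t − σ₀`, `σ₃ = 4u`; the registered `T₃` at `C + 2Z` with `E₂ = C₂ + 2CZ + 4Z₂`,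
`E₃ = C₃ + 2C₂Z + 4CZ₂ + 8Z₃`.  Conclusion: `T₃(C + 2Z) = −2⁷σ₂(β₀₁ + β₂₃)·H₂S₁ + 2⁸·(explicit)`.  Proof:
`T3_leading_edge` for the `Z`-free part, `C₂_eq_pfaffian`, and `linear_combination` (cofactors `−128σ₀Z` on the
Pfaffian form of `C₂` and `−128σ₀h₀h₁Z` on its oddness). -/
theorem T3Z_leading_edge_frame {R : Type*} [CommRing R] (h₀ h₁ σ₀ σ₁ σ₂ σ₃ s t u p nu β₀₁ β₂₃ H H₂ S₁ S₂
    S₃ N N₂ D D₂ D₃ C C₂ C₃ Z Z₂ Z₃ E₂ E₃ U₃Z : R)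
    (hU₃Z : U₃Z = σ₃ * D₃ - 4 * σ₂ * (D₂ * (C + 2 * Z)) + 16 * σ₁ * (D * E₂) - 64 * σ₀ * E₃)
    (hE₂ : E₂ = C₂ + 2 * (C * Z) + 4 * Z₂) (hE₃ : E₃ = C₃ + 2 * (C₂ * Z) + 4 * (C * Z₂) + 8 * Z₃)
    (hD : D = 4 * H + 8 * S₁) (hD₂ : D₂ = 16 * H₂ + 32 * (H * S₁) + 64 * S₂)
    (hD₃ : D₃ = 128 * (H₂ * S₁) + 256 * (H * S₂) + 512 * S₃) (hC : C = β₀₁ * h₀ + β₂₃ * h₁ + N)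
    (hC₂ : C₂ = β₀₁ * β₂₃ * (h₀ * h₁) + (β₀₁ * h₀ + β₂₃ * h₁) * N + N₂)
    (hC₃ : C₃ = β₀₁ * β₂₃ * (h₀ * h₁) * N + (β₀₁ * h₀ + β₂₃ * h₁) * N₂) (hH : H = h₀ + h₁)
    (hH₂ : H₂ = h₀ * h₁) (qh₀ : h₀ * h₀ = 0) (qh₁ : h₁ * h₁ = 0) (zh₀N : h₀ * N = 0) (zh₁N : h₁ * N = 0)
    (hN₂ : N₂ = nu * (h₀ * h₁)) (hp : β₀₁ * β₂₃ + nu = 2 * p + 1)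
    (hσ₁ : σ₁ = 0) (hσ₂ : σ₂ = 4 * t - σ₀) (hσ₀ : σ₀ = 2 * s + 1) (hσ₃ : σ₃ = 4 * u) :
    U₃Z = (-128) * (σ₂ * (β₀₁ + β₂₃)) * (H₂ * S₁) + 256 * (2 * u * (H₂ * S₁) + 4 * u * (H * S₂) + 8 *
      u * S₃ - σ₂ * (C * S₂) - 2 * t * (H₂ * Z) - p * σ₀ * (H₂ * Z) - σ₂ * (H * S₁ * Z)
      - 2 * σ₂ * (S₂ * Z) - σ₀ * (C * Z₂) - 2 * σ₀ * Z₃) := by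
  have hT := T3_leading_edge h₀ h₁ σ₀ σ₁ σ₂ σ₃ u nu β₀₁ β₂₃ H H₂ S₁ S₂ S₃ N N₂ D D₂ D₃ C C₂ C₃ _ rfl hD hD₂
    hD₃ hC hC₂ hC₃ hH hH₂ qh₀ qh₁ zh₀N zh₁N hN₂ hσ₁ hσ₃
  have hC2 := C₂_eq_pfaffian h₀ h₁ nu β₀₁ β₂₃ N N₂ C₂ hC₂ zh₀N zh₁N hN₂
  subst hU₃Z hE₂ hE₃ hD₂ hH₂ hσ₁ hσ₂ hσ₀
  linear_combination hT + (-128 * (2 * s + 1) * Z) * hC2 + (-128 * (2 * s + 1) * (h₀ * h₁) * Z) * hp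

variable {M : Type*} [AddCommGroup M] [Module ℤ M]

/-- **LEMMA D(a) READING with remainder: the twelve (V)-kills of the edge unit, end to end.**  In
`ExteriorAlgebra ℤ M` (`M` free with a basis `x : Fin 12`; slots `hᵢ = ι x_{2i} ι x_{2i+1}`, cross lines
`l₁, …, l₄` of the slot pair `0, 1`), for a leading digit `C = β₀₁h₀ + β₂₃h₁ + N`, `N = n₁l₁ + ⋯ + n₄l₄`, with
odd Pfaffian `β₀₁β₂₃ + ν = 2p + 1` (`ν = n₂n₃ − n₁n₄`) and ODD `β₀₁ + β₂₃ = 2r + 1`, ANY even remainder `Z` (with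
`Z₂, Z₃`), ANY even `S₂, S₃` (the closed forms enter only the `2⁸`-part) and σ-parameters any even elements:
`T₃(C + 2Z) ≠ 256·Z'` for every `Z'` — CRITERION L's `k = 3` congruence `≡ 0 mod 2^{10}` fails for every
completion of `C`: the memo's twelve `(3, 7, 8)` kills (S2-21 §2 ∕ §5 LEMMA D(a)) as a theorem.  Proof:
`T3Z_leading_edge_frame` in the commutative ring `Λ` (table entries from `TwoSlotFrameTable`), then
`Φ = τ ∘ Λ(π)`: `Φ(H₂S₁) = Φ(h₀h₁h₂) = 1` and `Φ(σ₂(β₀₁ + β₂₃)H₂S₁) = Φ((4t − 2s − 1)(2r + 1)H₂S₁)` is odd. -/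
theorem lemmaD_a_reading (x : Module.Basis (Fin 12) ℤ M) (Λ : Subalgebra ℤ (ExteriorAlgebra ℤ M))
    (h₀ h₁ l₁ l₂ l₃ l₄ h₂ h₃ h₄ h₅ σ₀ σ₁ σ₂ σ₃ s t u p r nu n₁ n₂ n₃ n₄ β₀₁ β₂₃ H H₂ S₁ S₂ S₃ N N₂ D D₂ D₃
    C C₂ C₃ Z Z₂ Z₃ E₂ E₃ U₃Z : ExteriorAlgebra ℤ M)
    (hΛ : Λ = Algebra.adjoin ℤ (Set.range fun p : M × M => ι ℤ p.1 * ι ℤ p.2))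
    (hh₀ : h₀ = ι ℤ (x 0) * ι ℤ (x 1)) (hh₁ : h₁ = ι ℤ (x 2) * ι ℤ (x 3)) (hl₁ : l₁ = ι ℤ (x 0) * ι ℤ (x 2))
    (hl₂ : l₂ = ι ℤ (x 0) * ι ℤ (x 3)) (hl₃ : l₃ = ι ℤ (x 1) * ι ℤ (x 2)) (hl₄ : l₄ = ι ℤ (x 1) * ι ℤ (x 3))
    (hh₂ : h₂ = ι ℤ (x 4) * ι ℤ (x 5)) (hh₃ : h₃ = ι ℤ (x 6) * ι ℤ (x 7)) (hh₄ : h₄ = ι ℤ (x 8) * ι ℤ (x 9))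
    (hh₅ : h₅ = ι ℤ (x 10) * ι ℤ (x 11)) (ms : s ∈ Λ) (mt : t ∈ Λ) (mu : u ∈ Λ) (mp : p ∈ Λ) (mr : r ∈ Λ)
    (mn₁ : n₁ ∈ Λ) (mn₂ : n₂ ∈ Λ) (mn₃ : n₃ ∈ Λ) (mn₄ : n₄ ∈ Λ) (mβ₀₁ : β₀₁ ∈ Λ) (mβ₂₃ : β₂₃ ∈ Λ)
    (mS₂ : S₂ ∈ Λ) (mS₃ : S₃ ∈ Λ) (mZ : Z ∈ Λ) (mZ₂ : Z₂ ∈ Λ) (mZ₃ : Z₃ ∈ Λ)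
    (hH : H = h₀ + h₁) (hH₂ : H₂ = h₀ * h₁) (hS₁ : S₁ = h₂ + h₃ + h₄ + h₅)
    (hN : N = n₁ * l₁ + n₂ * l₂ + n₃ * l₃ + n₄ * l₄) (hnu : nu = n₂ * n₃ - n₁ * n₄)
    (hN₂ : N₂ = n₁ * l₁ * (n₂ * l₂) + n₁ * l₁ * (n₃ * l₃) + n₁ * l₁ * (n₄ * l₄) + n₂ * l₂ * (n₃ * l₃)
      + n₂ * l₂ * (n₄ * l₄) + n₃ * l₃ * (n₄ * l₄))
    (hD : D = 4 * H + 8 * S₁) (hD₂ : D₂ = 16 * H₂ + 32 * (H * S₁) + 64 * S₂)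
    (hD₃ : D₃ = 128 * (H₂ * S₁) + 256 * (H * S₂) + 512 * S₃) (hC : C = β₀₁ * h₀ + β₂₃ * h₁ + N)
    (hC₂ : C₂ = β₀₁ * β₂₃ * (h₀ * h₁) + (β₀₁ * h₀ + β₂₃ * h₁) * N + N₂)
    (hC₃ : C₃ = β₀₁ * β₂₃ * (h₀ * h₁) * N + (β₀₁ * h₀ + β₂₃ * h₁) * N₂)
    (hE₂ : E₂ = C₂ + 2 * (C * Z) + 4 * Z₂) (hE₃ : E₃ = C₃ + 2 * (C₂ * Z) + 4 * (C * Z₂) + 8 * Z₃)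
    (hU₃Z : U₃Z = σ₃ * D₃ - 4 * σ₂ * (D₂ * (C + 2 * Z)) + 16 * σ₁ * (D * E₂) - 64 * σ₀ * E₃)
    (hp : β₀₁ * β₂₃ + nu = 2 * p + 1) (hr : β₀₁ + β₂₃ = 2 * r + 1)
    (hσ₁ : σ₁ = 0) (hσ₂ : σ₂ = 4 * t - σ₀) (hσ₀ : σ₀ = 2 * s + 1) (hσ₃ : σ₃ = 4 * u) :
    ∀ Z' : ExteriorAlgebra ℤ M, U₃Z ≠ 256 * Z' := by
  intro Z' hZ
  obtain ⟨W, hW⟩ : ∃ W, U₃Z = (-128) * (σ₂ * (β₀₁ + β₂₃)) * (H₂ * S₁) + 256 * W := by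
    subst hΛ
    haveI := TwoSlotGlue.isMulCommutative_twoVectorSubalgebra (R := ℤ) (M := M)
    set Λ := Algebra.adjoin ℤ (Set.range fun p : M × M => ι ℤ p.1 * ι ℤ p.2)
    have mh₀ : h₀ ∈ Λ := Algebra.subset_adjoin ⟨(x 0, x 1), hh₀.symm⟩
    have mh₁ : h₁ ∈ Λ := Algebra.subset_adjoin ⟨(x 2, x 3), hh₁.symm⟩
    have ml₁ : l₁ ∈ Λ := Algebra.subset_adjoin ⟨(x 0, x 2), hl₁.symm⟩
    have ml₂ : l₂ ∈ Λ := Algebra.subset_adjoin ⟨(x 0, x 3), hl₂.symm⟩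
    have ml₃ : l₃ ∈ Λ := Algebra.subset_adjoin ⟨(x 1, x 2), hl₃.symm⟩
    have ml₄ : l₄ ∈ Λ := Algebra.subset_adjoin ⟨(x 1, x 3), hl₄.symm⟩
    have mh₂ : h₂ ∈ Λ := Algebra.subset_adjoin ⟨(x 4, x 5), hh₂.symm⟩
    have mh₃ : h₃ ∈ Λ := Algebra.subset_adjoin ⟨(x 6, x 7), hh₃.symm⟩
    have mh₄ : h₄ ∈ Λ := Algebra.subset_adjoin ⟨(x 8, x 9), hh₄.symm⟩
    have mh₅ : h₅ ∈ Λ := Algebra.subset_adjoin ⟨(x 10, x 11), hh₅.symm⟩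
    -- table entries needed, as equations in Λ
    have qh₀ : (⟨h₀, mh₀⟩ : Λ) * ⟨h₀, mh₀⟩ = 0 := Subtype.ext (by subst hh₀; exact twoVector_mul_self (x 0) (x 1))
    have qh₁ : (⟨h₁, mh₁⟩ : Λ) * ⟨h₁, mh₁⟩ = 0 := Subtype.ext (by subst hh₁; exact twoVector_mul_self (x 2) (x 3))
    have zh₀l₁ : (⟨h₀, mh₀⟩ : Λ) * ⟨l₁, ml₁⟩ = 0 :=
      Subtype.ext (by subst hh₀ hl₁; exact table_zero_ff (x 0) (x 1) (x 2))
    have zh₀l₂ : (⟨h₀, mh₀⟩ : Λ) * ⟨l₂, ml₂⟩ = 0 :=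
      Subtype.ext (by subst hh₀ hl₂; exact table_zero_ff (x 0) (x 1) (x 3))
    have zh₀l₃ : (⟨h₀, mh₀⟩ : Λ) * ⟨l₃, ml₃⟩ = 0 :=
      Subtype.ext (by subst hh₀ hl₃; exact table_zero_st (x 0) (x 1) (x 2))
    have zh₀l₄ : (⟨h₀, mh₀⟩ : Λ) * ⟨l₄, ml₄⟩ = 0 :=
      Subtype.ext (by subst hh₀ hl₄; exact table_zero_st (x 0) (x 1) (x 3))
    have zh₁l₁ : (⟨h₁, mh₁⟩ : Λ) * ⟨l₁, ml₁⟩ = 0 :=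
      Subtype.ext (by subst hh₁ hl₁; exact table_zero_fl (x 2) (x 3) (x 0))
    have zh₁l₂ : (⟨h₁, mh₁⟩ : Λ) * ⟨l₂, ml₂⟩ = 0 :=
      Subtype.ext (by subst hh₁ hl₂; exact table_zero_sl (x 2) (x 3) (x 0))
    have zh₁l₃ : (⟨h₁, mh₁⟩ : Λ) * ⟨l₃, ml₃⟩ = 0 :=
      Subtype.ext (by subst hh₁ hl₃; exact table_zero_fl (x 2) (x 3) (x 1))
    have zh₁l₄ : (⟨h₁, mh₁⟩ : Λ) * ⟨l₄, ml₄⟩ = 0 :=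
      Subtype.ext (by subst hh₁ hl₄; exact table_zero_sl (x 2) (x 3) (x 1))
    have zl₁l₂ : (⟨l₁, ml₁⟩ : Λ) * ⟨l₂, ml₂⟩ = 0 :=
      Subtype.ext (by subst hl₁ hl₂; exact table_zero_ff (x 0) (x 2) (x 3))
    have zl₁l₃ : (⟨l₁, ml₁⟩ : Λ) * ⟨l₃, ml₃⟩ = 0 :=
      Subtype.ext (by subst hl₁ hl₃; exact table_zero_sl (x 0) (x 2) (x 1))
    have zl₂l₄ : (⟨l₂, ml₂⟩ : Λ) * ⟨l₄, ml₄⟩ = 0 :=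
      Subtype.ext (by subst hl₂ hl₄; exact table_zero_sl (x 0) (x 3) (x 1))
    have zl₃l₄ : (⟨l₃, ml₃⟩ : Λ) * ⟨l₄, ml₄⟩ = 0 :=
      Subtype.ext (by subst hl₃ hl₄; exact table_zero_ff (x 1) (x 2) (x 3))
    have pl₁l₄ : (⟨l₁, ml₁⟩ : Λ) * ⟨l₄, ml₄⟩ = -(⟨h₀, mh₀⟩ * ⟨h₁, mh₁⟩) :=
      Subtype.ext (by subst hl₁ hl₄ hh₀ hh₁; exact (table_signed (x 0) (x 1) (x 2) (x 3)).1)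
    have pl₂l₃ : (⟨l₂, ml₂⟩ : Λ) * ⟨l₃, ml₃⟩ = ⟨h₀, mh₀⟩ * ⟨h₁, mh₁⟩ :=
      Subtype.ext (by subst hl₂ hl₃ hh₀ hh₁; exact (table_signed (x 0) (x 1) (x 2) (x 3)).2)
    -- the cross-line facts `h₀N = h₁N = 0`, `N₂ = ν·h₀h₁` in Λ
    have mN : N ∈ Λ := by
      subst hN; exact Λ.add_mem (Λ.add_mem (Λ.add_mem (Λ.mul_mem mn₁ ml₁) (Λ.mul_mem mn₂ ml₂))
        (Λ.mul_mem mn₃ ml₃)) (Λ.mul_mem mn₄ ml₄)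
    have hNΛ : (⟨N, mN⟩ : Λ) = ⟨n₁, mn₁⟩ * ⟨l₁, ml₁⟩ + ⟨n₂, mn₂⟩ * ⟨l₂, ml₂⟩ + ⟨n₃, mn₃⟩ * ⟨l₃, ml₃⟩
        + ⟨n₄, mn₄⟩ * ⟨l₄, ml₄⟩ := Subtype.ext (by push_cast; exact hN)
    have zh₀N := crossLine_h₀ (⟨h₀, mh₀⟩ : Λ) ⟨l₁, ml₁⟩ ⟨l₂, ml₂⟩ ⟨l₃, ml₃⟩ ⟨l₄, ml₄⟩ ⟨n₁, mn₁⟩ ⟨n₂, mn₂⟩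
      ⟨n₃, mn₃⟩ ⟨n₄, mn₄⟩ ⟨N, mN⟩ hNΛ zh₀l₁ zh₀l₂ zh₀l₃ zh₀l₄
    have zh₁N := crossLine_h₁ (⟨h₁, mh₁⟩ : Λ) ⟨l₁, ml₁⟩ ⟨l₂, ml₂⟩ ⟨l₃, ml₃⟩ ⟨l₄, ml₄⟩ ⟨n₁, mn₁⟩ ⟨n₂, mn₂⟩
      ⟨n₃, mn₃⟩ ⟨n₄, mn₄⟩ ⟨N, mN⟩ hNΛ zh₁l₁ zh₁l₂ zh₁l₃ zh₁l₄
    have mN₂ : N₂ ∈ Λ := by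
      subst hN₂
      exact Λ.add_mem (Λ.add_mem (Λ.add_mem (Λ.add_mem (Λ.add_mem
        (Λ.mul_mem (Λ.mul_mem mn₁ ml₁) (Λ.mul_mem mn₂ ml₂)) (Λ.mul_mem (Λ.mul_mem mn₁ ml₁) (Λ.mul_mem mn₃ ml₃)))
        (Λ.mul_mem (Λ.mul_mem mn₁ ml₁) (Λ.mul_mem mn₄ ml₄))) (Λ.mul_mem (Λ.mul_mem mn₂ ml₂) (Λ.mul_mem mn₃ ml₃)))
        (Λ.mul_mem (Λ.mul_mem mn₂ ml₂) (Λ.mul_mem mn₄ ml₄))) (Λ.mul_mem (Λ.mul_mem mn₃ ml₃) (Λ.mul_mem mn₄ ml₄))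
    have hN₂Λ := crossLine_dividedSquare (⟨h₀, mh₀⟩ : Λ) ⟨h₁, mh₁⟩ ⟨l₁, ml₁⟩ ⟨l₂, ml₂⟩ ⟨l₃, ml₃⟩ ⟨l₄, ml₄⟩
      ⟨n₁, mn₁⟩ ⟨n₂, mn₂⟩ ⟨n₃, mn₃⟩ ⟨n₄, mn₄⟩ ⟨N₂, mN₂⟩ (Subtype.ext (by push_cast; exact hN₂)) zl₁l₂ zl₁l₃
      zl₂l₄ zl₃l₄ pl₁l₄ pl₂l₃
    refine ⟨2 * u * (H₂ * S₁) + 4 * u * (H * S₂) + 8 * u * S₃ - σ₂ * (C * S₂) - 2 * t * (H₂ * Z)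
      - p * σ₀ * (H₂ * Z) - σ₂ * (H * S₁ * Z) - 2 * σ₂ * (S₂ * Z) - σ₀ * (C * Z₂) - 2 * σ₀ * Z₃, ?_⟩
    have mS₁ : S₁ ∈ Λ := by subst hS₁; exact Λ.add_mem (Λ.add_mem (Λ.add_mem mh₂ mh₃) mh₄) mh₅
    subst hH hH₂ hD hD₂ hD₃ hC hC₂ hC₃ hE₂ hE₃ hU₃Z hσ₁ hσ₂ hσ₀ hσ₃ hnu
    have key := congrArg Subtype.val
      (T3Z_leading_edge_frame (R := Λ) ⟨h₀, mh₀⟩ ⟨h₁, mh₁⟩ _ _ _ _ ⟨s, ms⟩ ⟨t, mt⟩ ⟨u, mu⟩ ⟨p, mp⟩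
        (⟨n₂, mn₂⟩ * ⟨n₃, mn₃⟩ - ⟨n₁, mn₁⟩ * ⟨n₄, mn₄⟩) ⟨β₀₁, mβ₀₁⟩ ⟨β₂₃, mβ₂₃⟩ _ _ ⟨S₁, mS₁⟩ ⟨S₂, mS₂⟩
        ⟨S₃, mS₃⟩ ⟨N, mN⟩ ⟨N₂, mN₂⟩ _ _ _ _ _ _ ⟨Z, mZ⟩ ⟨Z₂, mZ₂⟩ ⟨Z₃, mZ₃⟩ _ _ _ rfl rfl rfl rfl rfl rfl
        rfl rfl rfl rfl rfl qh₀ qh₁ zh₀N zh₁N hN₂Λ (Subtype.ext (by push_cast; exact hp)) rfl rfl rfl rfl)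
    push_cast at key ⊢
    exact key
  obtain ⟨τ, hτ⟩ := exists_topCoeff ℤ 6
  rw [hZ, hσ₂, hσ₀, hH₂, hS₁] at hW
  have key := congrArg (fun z => τ (ExteriorAlgebra.map
    (LinearMap.funLeft ℤ ℤ (Fin.castLE (show 6 ≤ 12 by decide)) ∘ₗ (x.equivFun : M →ₗ[ℤ] (Fin 12 → ℤ))) z)) hW
  rw [show β₀₁ + β₂₃ = 2 * r + 1 from hr] at key
  subst hh₀ hh₁ hh₂ hh₃ hh₄ hh₅
  simp only [map_mul, map_add, map_sub, map_neg, map_apply_ι, projSix_basis, Matrix.cons_val, map_ofNat,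
    map_zero, mul_zero, mul_add, add_mul, sub_mul, mul_sub, one_mul, mul_one, neg_mul,
    mul_assoc, prod_six_eq_ιMulti, apply_ofNat_mul τ 256, apply_ofNat_mul τ 128, apply_ofNat_mul τ 4,
    apply_ofNat_mul τ 2, hτ] at key
  norm_num at key
  omega

/-! ### The (β) step and the chain for the fifteen leading digits: criterion ⇒ digit equation ⇒ contradiction -/

/-- **Torsion-freeness of `Λ^•M` (the memo's «iff», item (β)).**  For a free `ℤ`-module `M` with a basis
`x : Fin 12`, `ExteriorAlgebra ℤ M` is a free `ℤ`-module (Mathlib's `Basis.ExteriorAlgebra`), so a non-zero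
integer can be cancelled: `n·Q = n·Q' ⇒ Q = Q'`.  Proof through the integer coordinates `x.ExteriorAlgebra.coord`
(each is a `ℤ`-linear functional; `TwoAdicReadings.apply_intCast_mul`) and `Basis.ext_elem` — this is the one
place where a basis theorem for the exterior algebra is used. -/
theorem natCast_mul_cancel (x : Module.Basis (Fin 12) ℤ M) (n : ℕ) (hn : n ≠ 0) (Q Q' : ExteriorAlgebra ℤ M)
    (h : (n : ExteriorAlgebra ℤ M) * Q = n * Q') : Q = Q' := by
  refine x.ExteriorAlgebra.ext_elem fun s => ?_
  have key := congrArg (x.ExteriorAlgebra.coord s) h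
  rw [← Int.cast_natCast, apply_intCast_mul, apply_intCast_mul] at key
  simpa only [Module.Basis.coord_apply] using mul_left_cancel₀ (by exact_mod_cast hn) key

/-- **LEMMA A(a), the whole chain for a leading digit off `H̄` (criterion at `k = 2` ⇒ contradiction).**  In
`ExteriorAlgebra ℤ M` (`M` free, basis `x : Fin 12`; slots, cross lines, all parameters ANY even elements):
a non-degenerate leading digit `C = β₀₁h₀ + β₂₃h₁ + N` (`N = n₁l₁ + ⋯ + n₄l₄`, odd Pfaffian
`β₀₁β₂₃ + ν = 2p + 1`), a cross-line functional `F = c₁l₁ + ⋯ + c₄l₄` with EVEN pairing `β₂₃ + ϖ = 2m`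
(`ϖ = c₂n₃ + c₃n₂ − c₁n₄ − c₄n₁`), ANY first digit `X` and remainder `Y` (divided squares `X₂, Y₂`), the registered
`T₂` at `C + 2X + 4Y` (`E` its divided square, `DegreeSixSecondDigit.sq_leading`).  IF CRITERION L holds at
`k = 2`, i.e. `T₂ = 64·Z` with `Z` even, THEN `False`.  Proof = the three kernel pieces in a row:
`DegreeSixSecondDigit.T2_leading` in the commutative ring `Λ` gives `T₂ = 32·(pH₂ − HS₁ + CX) + 64·W₁`;
`natCast_mul_cancel` (β) turns `T₂ = 64·Z` into the digit equation `pH₂ − HS₁ + CX = 2·(Z − W₁)`;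
`TwoAdicReadings.lemmaA_a_reading` (LEMMA A(a)'s obstruction + the top-class reading) refutes it.  What stays
with the memo: that such an `F` exists for 15 of the 16 (V)-surviving digits (the two-line case split in
`T2_leading`'s docstring) and the list of digits. -/
theorem lemmaA_a_chain (x : Module.Basis (Fin 12) ℤ M) (Λ : Subalgebra ℤ (ExteriorAlgebra ℤ M))
    (h₀ h₁ l₁ l₂ l₃ l₄ h₂ h₃ h₄ h₅ σ₀ σ₁ σ₂ s t p m ϖ n₁ n₂ n₃ n₄ c₁ c₂ c₃ c₄ β₀₁ β₂₃ H H₂ S₁ S₂ S₄ G N N₂ F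
    C C₂ X X₂ Y Y₂ E D D₂ T₂ Z : ExteriorAlgebra ℤ M)
    (hΛ : Λ = Algebra.adjoin ℤ (Set.range fun p : M × M => ι ℤ p.1 * ι ℤ p.2))
    (hh₀ : h₀ = ι ℤ (x 0) * ι ℤ (x 1)) (hh₁ : h₁ = ι ℤ (x 2) * ι ℤ (x 3)) (hl₁ : l₁ = ι ℤ (x 0) * ι ℤ (x 2))
    (hl₂ : l₂ = ι ℤ (x 0) * ι ℤ (x 3)) (hl₃ : l₃ = ι ℤ (x 1) * ι ℤ (x 2)) (hl₄ : l₄ = ι ℤ (x 1) * ι ℤ (x 3))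
    (hh₂ : h₂ = ι ℤ (x 4) * ι ℤ (x 5)) (hh₃ : h₃ = ι ℤ (x 6) * ι ℤ (x 7)) (hh₄ : h₄ = ι ℤ (x 8) * ι ℤ (x 9))
    (hh₅ : h₅ = ι ℤ (x 10) * ι ℤ (x 11)) (ms : s ∈ Λ) (mt : t ∈ Λ) (mp : p ∈ Λ) (mm : m ∈ Λ) (mn₁ : n₁ ∈ Λ)
    (mn₂ : n₂ ∈ Λ) (mn₃ : n₃ ∈ Λ) (mn₄ : n₄ ∈ Λ) (mc₁ : c₁ ∈ Λ) (mc₂ : c₂ ∈ Λ) (mc₃ : c₃ ∈ Λ) (mc₄ : c₄ ∈ Λ)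
    (mβ₀₁ : β₀₁ ∈ Λ) (mβ₂₃ : β₂₃ ∈ Λ) (mS₂ : S₂ ∈ Λ) (mX : X ∈ Λ) (mX₂ : X₂ ∈ Λ) (mY : Y ∈ Λ) (mY₂ : Y₂ ∈ Λ)
    (mZ : Z ∈ Λ)
    (hH : H = h₀ + h₁) (hH₂ : H₂ = h₀ * h₁) (hS₁ : S₁ = h₂ + h₃ + h₄ + h₅) (hS₄ : S₄ = h₂ * h₃ * h₄ * h₅)
    (hG : G = h₃ * h₄ * h₅) (hN : N = n₁ * l₁ + n₂ * l₂ + n₃ * l₃ + n₄ * l₄)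
    (hN₂ : N₂ = n₁ * l₁ * (n₂ * l₂) + n₁ * l₁ * (n₃ * l₃) + n₁ * l₁ * (n₄ * l₄) + n₂ * l₂ * (n₃ * l₃)
      + n₂ * l₂ * (n₄ * l₄) + n₃ * l₃ * (n₄ * l₄))
    (hF : F = c₁ * l₁ + c₂ * l₂ + c₃ * l₃ + c₄ * l₄) (hϖ : ϖ = c₂ * n₃ + c₃ * n₂ - c₁ * n₄ - c₄ * n₁)
    (hC : C = β₀₁ * h₀ + β₂₃ * h₁ + N) (hC₂ : C₂ = β₀₁ * β₂₃ * (h₀ * h₁) + (β₀₁ * h₀ + β₂₃ * h₁) * N + N₂)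
    (hE : E = C₂ + 2 * (C * X) + 4 * (C * Y) + 4 * X₂ + 8 * (X * Y) + 16 * Y₂)
    (hD : D = 4 * H + 8 * S₁) (hD₂ : D₂ = 16 * H₂ + 32 * (H * S₁) + 64 * S₂)
    (hT₂ : T₂ = σ₂ * D₂ - 4 * σ₁ * (D * (C + 2 * X + 4 * Y)) + 16 * σ₀ * E)
    (hp : β₀₁ * β₂₃ + (n₂ * n₃ - n₁ * n₄) = 2 * p + 1) (hm : β₂₃ + ϖ = 2 * m)
    (hσ₁ : σ₁ = 0) (hσ₂ : σ₂ = 4 * t - σ₀) (hσ₀ : σ₀ = 2 * s + 1) (hcrit : T₂ = 64 * Z) : False := by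
  -- LEMMA A(a)'s reading, with the solution `W` of the digit equation universally quantified
  have hne : ∀ W ∈ Λ, p * H₂ - H * S₁ + C * X ≠ 2 * W := fun W mW =>
    lemmaA_a_reading x Λ h₀ h₁ l₁ l₂ l₃ l₄ h₂ h₃ h₄ h₅ p m ϖ n₁ n₂ n₃ n₄ c₁ c₂ c₃ c₄ β₀₁ β₂₃ H H₂ S₁ S₄ G N F C
      X W hΛ hh₀ hh₁ hl₁ hl₂ hl₃ hl₄ hh₂ hh₃ hh₄ hh₅ mp mm mn₁ mn₂ mn₃ mn₄ mc₁ mc₂ mc₃ mc₄ mβ₀₁ mβ₂₃ mX mW hH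
      hH₂ hS₁ hS₄ hG hN hF hϖ hC hm
  -- `T2_leading` in the commutative ring Λ
  subst hΛ
  haveI := TwoSlotGlue.isMulCommutative_twoVectorSubalgebra (R := ℤ) (M := M)
  set Λ := Algebra.adjoin ℤ (Set.range fun p : M × M => ι ℤ p.1 * ι ℤ p.2)
  have mh₀ : h₀ ∈ Λ := Algebra.subset_adjoin ⟨(x 0, x 1), hh₀.symm⟩
  have mh₁ : h₁ ∈ Λ := Algebra.subset_adjoin ⟨(x 2, x 3), hh₁.symm⟩
  have ml₁ : l₁ ∈ Λ := Algebra.subset_adjoin ⟨(x 0, x 2), hl₁.symm⟩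
  have ml₂ : l₂ ∈ Λ := Algebra.subset_adjoin ⟨(x 0, x 3), hl₂.symm⟩
  have ml₃ : l₃ ∈ Λ := Algebra.subset_adjoin ⟨(x 1, x 2), hl₃.symm⟩
  have ml₄ : l₄ ∈ Λ := Algebra.subset_adjoin ⟨(x 1, x 3), hl₄.symm⟩
  have mh₂ : h₂ ∈ Λ := Algebra.subset_adjoin ⟨(x 4, x 5), hh₂.symm⟩
  have mh₃ : h₃ ∈ Λ := Algebra.subset_adjoin ⟨(x 6, x 7), hh₃.symm⟩
  have mh₄ : h₄ ∈ Λ := Algebra.subset_adjoin ⟨(x 8, x 9), hh₄.symm⟩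
  have mh₅ : h₅ ∈ Λ := Algebra.subset_adjoin ⟨(x 10, x 11), hh₅.symm⟩
  have qh₀ : (⟨h₀, mh₀⟩ : Λ) * ⟨h₀, mh₀⟩ = 0 := Subtype.ext (by subst hh₀; exact twoVector_mul_self (x 0) (x 1))
  have qh₁ : (⟨h₁, mh₁⟩ : Λ) * ⟨h₁, mh₁⟩ = 0 := Subtype.ext (by subst hh₁; exact twoVector_mul_self (x 2) (x 3))
  have zh₀l₁ : (⟨h₀, mh₀⟩ : Λ) * ⟨l₁, ml₁⟩ = 0 :=
    Subtype.ext (by subst hh₀ hl₁; exact table_zero_ff (x 0) (x 1) (x 2))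
  have zh₀l₂ : (⟨h₀, mh₀⟩ : Λ) * ⟨l₂, ml₂⟩ = 0 :=
    Subtype.ext (by subst hh₀ hl₂; exact table_zero_ff (x 0) (x 1) (x 3))
  have zh₀l₃ : (⟨h₀, mh₀⟩ : Λ) * ⟨l₃, ml₃⟩ = 0 :=
    Subtype.ext (by subst hh₀ hl₃; exact table_zero_st (x 0) (x 1) (x 2))
  have zh₀l₄ : (⟨h₀, mh₀⟩ : Λ) * ⟨l₄, ml₄⟩ = 0 :=
    Subtype.ext (by subst hh₀ hl₄; exact table_zero_st (x 0) (x 1) (x 3))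
  have zh₁l₁ : (⟨h₁, mh₁⟩ : Λ) * ⟨l₁, ml₁⟩ = 0 :=
    Subtype.ext (by subst hh₁ hl₁; exact table_zero_fl (x 2) (x 3) (x 0))
  have zh₁l₂ : (⟨h₁, mh₁⟩ : Λ) * ⟨l₂, ml₂⟩ = 0 :=
    Subtype.ext (by subst hh₁ hl₂; exact table_zero_sl (x 2) (x 3) (x 0))
  have zh₁l₃ : (⟨h₁, mh₁⟩ : Λ) * ⟨l₃, ml₃⟩ = 0 :=
    Subtype.ext (by subst hh₁ hl₃; exact table_zero_fl (x 2) (x 3) (x 1))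
  have zh₁l₄ : (⟨h₁, mh₁⟩ : Λ) * ⟨l₄, ml₄⟩ = 0 :=
    Subtype.ext (by subst hh₁ hl₄; exact table_zero_sl (x 2) (x 3) (x 1))
  have zl₁l₂ : (⟨l₁, ml₁⟩ : Λ) * ⟨l₂, ml₂⟩ = 0 :=
    Subtype.ext (by subst hl₁ hl₂; exact table_zero_ff (x 0) (x 2) (x 3))
  have zl₁l₃ : (⟨l₁, ml₁⟩ : Λ) * ⟨l₃, ml₃⟩ = 0 :=
    Subtype.ext (by subst hl₁ hl₃; exact table_zero_sl (x 0) (x 2) (x 1))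
  have zl₂l₄ : (⟨l₂, ml₂⟩ : Λ) * ⟨l₄, ml₄⟩ = 0 :=
    Subtype.ext (by subst hl₂ hl₄; exact table_zero_sl (x 0) (x 3) (x 1))
  have zl₃l₄ : (⟨l₃, ml₃⟩ : Λ) * ⟨l₄, ml₄⟩ = 0 :=
    Subtype.ext (by subst hl₃ hl₄; exact table_zero_ff (x 1) (x 2) (x 3))
  have pl₁l₄ : (⟨l₁, ml₁⟩ : Λ) * ⟨l₄, ml₄⟩ = -(⟨h₀, mh₀⟩ * ⟨h₁, mh₁⟩) :=
    Subtype.ext (by subst hl₁ hl₄ hh₀ hh₁; exact (table_signed (x 0) (x 1) (x 2) (x 3)).1)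
  have pl₂l₃ : (⟨l₂, ml₂⟩ : Λ) * ⟨l₃, ml₃⟩ = ⟨h₀, mh₀⟩ * ⟨h₁, mh₁⟩ :=
    Subtype.ext (by subst hl₂ hl₃ hh₀ hh₁; exact (table_signed (x 0) (x 1) (x 2) (x 3)).2)
  have mN : N ∈ Λ := by
    subst hN; exact Λ.add_mem (Λ.add_mem (Λ.add_mem (Λ.mul_mem mn₁ ml₁) (Λ.mul_mem mn₂ ml₂))
      (Λ.mul_mem mn₃ ml₃)) (Λ.mul_mem mn₄ ml₄)
  have hNΛ : (⟨N, mN⟩ : Λ) = ⟨n₁, mn₁⟩ * ⟨l₁, ml₁⟩ + ⟨n₂, mn₂⟩ * ⟨l₂, ml₂⟩ + ⟨n₃, mn₃⟩ * ⟨l₃, ml₃⟩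
      + ⟨n₄, mn₄⟩ * ⟨l₄, ml₄⟩ := Subtype.ext (by push_cast; exact hN)
  have zh₀N := crossLine_h₀ (⟨h₀, mh₀⟩ : Λ) ⟨l₁, ml₁⟩ ⟨l₂, ml₂⟩ ⟨l₃, ml₃⟩ ⟨l₄, ml₄⟩ ⟨n₁, mn₁⟩ ⟨n₂, mn₂⟩
    ⟨n₃, mn₃⟩ ⟨n₄, mn₄⟩ ⟨N, mN⟩ hNΛ zh₀l₁ zh₀l₂ zh₀l₃ zh₀l₄
  have zh₁N := crossLine_h₁ (⟨h₁, mh₁⟩ : Λ) ⟨l₁, ml₁⟩ ⟨l₂, ml₂⟩ ⟨l₃, ml₃⟩ ⟨l₄, ml₄⟩ ⟨n₁, mn₁⟩ ⟨n₂, mn₂⟩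
    ⟨n₃, mn₃⟩ ⟨n₄, mn₄⟩ ⟨N, mN⟩ hNΛ zh₁l₁ zh₁l₂ zh₁l₃ zh₁l₄
  have mN₂ : N₂ ∈ Λ := by
    subst hN₂
    exact Λ.add_mem (Λ.add_mem (Λ.add_mem (Λ.add_mem (Λ.add_mem
      (Λ.mul_mem (Λ.mul_mem mn₁ ml₁) (Λ.mul_mem mn₂ ml₂)) (Λ.mul_mem (Λ.mul_mem mn₁ ml₁) (Λ.mul_mem mn₃ ml₃)))
      (Λ.mul_mem (Λ.mul_mem mn₁ ml₁) (Λ.mul_mem mn₄ ml₄))) (Λ.mul_mem (Λ.mul_mem mn₂ ml₂) (Λ.mul_mem mn₃ ml₃)))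
      (Λ.mul_mem (Λ.mul_mem mn₂ ml₂) (Λ.mul_mem mn₄ ml₄))) (Λ.mul_mem (Λ.mul_mem mn₃ ml₃) (Λ.mul_mem mn₄ ml₄))
  have hN₂Λ := crossLine_dividedSquare (⟨h₀, mh₀⟩ : Λ) ⟨h₁, mh₁⟩ ⟨l₁, ml₁⟩ ⟨l₂, ml₂⟩ ⟨l₃, ml₃⟩ ⟨l₄, ml₄⟩
    ⟨n₁, mn₁⟩ ⟨n₂, mn₂⟩ ⟨n₃, mn₃⟩ ⟨n₄, mn₄⟩ ⟨N₂, mN₂⟩ (Subtype.ext (by push_cast; exact hN₂)) zl₁l₂ zl₁l₃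
    zl₂l₄ zl₃l₄ pl₁l₄ pl₂l₃
  have mS₁ : S₁ ∈ Λ := by subst hS₁; exact Λ.add_mem (Λ.add_mem (Λ.add_mem mh₂ mh₃) mh₄) mh₅
  have hPfΛ : (⟨n₂, mn₂⟩ * ⟨n₃, mn₃⟩ - ⟨n₁, mn₁⟩ * ⟨n₄, mn₄⟩ : Λ)
      = 2 * ⟨p, mp⟩ + 1 - ⟨β₀₁, mβ₀₁⟩ * ⟨β₂₃, mβ₂₃⟩ :=
    Subtype.ext (by change n₂ * n₃ - n₁ * n₄ = 2 * p + 1 - β₀₁ * β₂₃; rw [← hp]; abel)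
  subst hH hH₂ hC hC₂ hE hD hD₂ hT₂ hσ₁ hσ₂ hσ₀
  have pack : ∀ {T Q W : Λ}, T = 32 * Q + 64 * W → ∃ W' : Λ, T = 32 * Q + 64 * W' := fun h => ⟨_, h⟩
  obtain ⟨W₁, hW₁⟩ := pack (T2_leading (R := Λ) ⟨h₀, mh₀⟩ ⟨h₁, mh₁⟩ _ _ _ ⟨s, ms⟩ ⟨t, mt⟩ ⟨p, mp⟩ _
    ⟨β₀₁, mβ₀₁⟩ ⟨β₂₃, mβ₂₃⟩ _ _ ⟨S₁, mS₁⟩ ⟨S₂, mS₂⟩ ⟨N, mN⟩ ⟨N₂, mN₂⟩ _ _ _ _ ⟨X, mX⟩ ⟨X₂, mX₂⟩ ⟨Y, mY⟩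
    ⟨Y₂, mY₂⟩ _ _ rfl rfl rfl rfl rfl rfl rfl rfl qh₀ qh₁ zh₀N zh₁N hN₂Λ hPfΛ rfl rfl rfl)
  have key := congrArg Subtype.val hW₁
  push_cast at key
  have key' : (64 : ExteriorAlgebra ℤ M) * Z
      = 32 * (p * (h₀ * h₁) - (h₀ + h₁) * S₁ + (β₀₁ * h₀ + β₂₃ * h₁ + N) * X) + 64 * (W₁ : ExteriorAlgebra ℤ M) :=
    hcrit.symm.trans key
  -- the (β) step: cancel 32
  have h32 : (32 : ExteriorAlgebra ℤ M) * (p * (h₀ * h₁) - (h₀ + h₁) * S₁ + (β₀₁ * h₀ + β₂₃ * h₁ + N) * X)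
      = 32 * (2 * (Z - ↑W₁)) := by
    rw [eq_sub_of_add_eq key'.symm]
    simp only [mul_sub, ← mul_assoc]
    norm_num
  have hQ := natCast_mul_cancel x 32 (by norm_num) _ _ (by exact_mod_cast h32)
  exact hne (Z - ↑W₁) (Λ.sub_mem mZ W₁.2) hQ

/-- **The sixteenth digit `C̄ = H̄`: criterion at `k = 2` ⇒ the digit equation of the digit-space clause.**  In
`ExteriorAlgebra ℤ M` (`M` free, basis `x`), for the leading digit `H = h₀ + h₁` (Pfaffian `1`), ANY first
digit `X` and remainder `Y` (divided squares `X₂, Y₂`; `E` that of `H + 2X + 4Y`, `DegreeSixSecondDigit.sq_leading`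
with `C₂ = H₂`), σ-parameters any even elements: if CRITERION L holds at `k = 2`, `T₂(H + 2X + 4Y) = 64·Z` (`Z`
even), then `(ι x₀ ι x₁ + ι x₂ ι x₃)·(X − S₁) = 2·W` for some even `W` — exactly the hypothesis of
`DigitSpaceClause.digitSpace_clause` (with `Y := X − S₁` written in coordinates), whose conclusion feeds
`TwoAdicReadings.lemmaB_reading`.  Proof: `DegreeSixSecondDigit.T2_leading` at `β₀₁ = β₂₃ = 1`, `N = 0`, `p = 0`
in the commutative ring `Λ`, then `natCast_mul_cancel` (β). -/
theorem edge_digit_equation (x : Module.Basis (Fin 12) ℤ M) (Λ : Subalgebra ℤ (ExteriorAlgebra ℤ M))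
    (h₀ h₁ h₂ h₃ h₄ h₅ σ₀ σ₁ σ₂ s t H H₂ S₁ S₂ X X₂ Y Y₂ E D D₂ T₂ Z : ExteriorAlgebra ℤ M)
    (hΛ : Λ = Algebra.adjoin ℤ (Set.range fun p : M × M => ι ℤ p.1 * ι ℤ p.2))
    (hh₀ : h₀ = ι ℤ (x 0) * ι ℤ (x 1)) (hh₁ : h₁ = ι ℤ (x 2) * ι ℤ (x 3)) (hh₂ : h₂ = ι ℤ (x 4) * ι ℤ (x 5))
    (hh₃ : h₃ = ι ℤ (x 6) * ι ℤ (x 7)) (hh₄ : h₄ = ι ℤ (x 8) * ι ℤ (x 9)) (hh₅ : h₅ = ι ℤ (x 10) * ι ℤ (x 11))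
    (ms : s ∈ Λ) (mt : t ∈ Λ) (mS₂ : S₂ ∈ Λ) (mX : X ∈ Λ) (mX₂ : X₂ ∈ Λ) (mY : Y ∈ Λ) (mY₂ : Y₂ ∈ Λ)
    (mZ : Z ∈ Λ)
    (hH : H = h₀ + h₁) (hH₂ : H₂ = h₀ * h₁) (hS₁ : S₁ = h₂ + h₃ + h₄ + h₅)
    (hE : E = H₂ + 2 * (H * X) + 4 * (H * Y) + 4 * X₂ + 8 * (X * Y) + 16 * Y₂)
    (hD : D = 4 * H + 8 * S₁) (hD₂ : D₂ = 16 * H₂ + 32 * (H * S₁) + 64 * S₂)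
    (hT₂ : T₂ = σ₂ * D₂ - 4 * σ₁ * (D * (H + 2 * X + 4 * Y)) + 16 * σ₀ * E)
    (hσ₁ : σ₁ = 0) (hσ₂ : σ₂ = 4 * t - σ₀) (hσ₀ : σ₀ = 2 * s + 1) (hcrit : T₂ = 64 * Z) :
    ∃ W ∈ Λ, (ι ℤ (x 0) * ι ℤ (x 1) + ι ℤ (x 2) * ι ℤ (x 3)) * (X - S₁) = 2 * W := by
  subst hΛ
  haveI := TwoSlotGlue.isMulCommutative_twoVectorSubalgebra (R := ℤ) (M := M)
  set Λ := Algebra.adjoin ℤ (Set.range fun p : M × M => ι ℤ p.1 * ι ℤ p.2)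
  have mh₀ : h₀ ∈ Λ := Algebra.subset_adjoin ⟨(x 0, x 1), hh₀.symm⟩
  have mh₁ : h₁ ∈ Λ := Algebra.subset_adjoin ⟨(x 2, x 3), hh₁.symm⟩
  have mh₂ : h₂ ∈ Λ := Algebra.subset_adjoin ⟨(x 4, x 5), hh₂.symm⟩
  have mh₃ : h₃ ∈ Λ := Algebra.subset_adjoin ⟨(x 6, x 7), hh₃.symm⟩
  have mh₄ : h₄ ∈ Λ := Algebra.subset_adjoin ⟨(x 8, x 9), hh₄.symm⟩
  have mh₅ : h₅ ∈ Λ := Algebra.subset_adjoin ⟨(x 10, x 11), hh₅.symm⟩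
  have qh₀ : (⟨h₀, mh₀⟩ : Λ) * ⟨h₀, mh₀⟩ = 0 := Subtype.ext (by subst hh₀; exact twoVector_mul_self (x 0) (x 1))
  have qh₁ : (⟨h₁, mh₁⟩ : Λ) * ⟨h₁, mh₁⟩ = 0 := Subtype.ext (by subst hh₁; exact twoVector_mul_self (x 2) (x 3))
  have mS₁ : S₁ ∈ Λ := by subst hS₁; exact Λ.add_mem (Λ.add_mem (Λ.add_mem mh₂ mh₃) mh₄) mh₅
  subst hH hH₂ hE hD hD₂ hT₂ hσ₁ hσ₂ hσ₀
  have pack : ∀ {T Q W : Λ}, T = 32 * Q + 64 * W → ∃ W' : Λ, T = 32 * Q + 64 * W' := fun h => ⟨_, h⟩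
  -- `T2_leading` at C = H: β₀₁ = β₂₃ = 1, N = 0, ν = 0, p = 0 (Pfaffian 1)
  obtain ⟨W₁, hW₁⟩ := pack (T2_leading (R := Λ) ⟨h₀, mh₀⟩ ⟨h₁, mh₁⟩ _ _ _ ⟨s, ms⟩ ⟨t, mt⟩ 0 0 1 1
    (⟨h₀, mh₀⟩ + ⟨h₁, mh₁⟩) (⟨h₀, mh₀⟩ * ⟨h₁, mh₁⟩) ⟨S₁, mS₁⟩ ⟨S₂, mS₂⟩ 0 0 _ _ (⟨h₀, mh₀⟩ + ⟨h₁, mh₁⟩)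
    (⟨h₀, mh₀⟩ * ⟨h₁, mh₁⟩) ⟨X, mX⟩ ⟨X₂, mX₂⟩ ⟨Y, mY⟩ ⟨Y₂, mY₂⟩ _ _ rfl rfl rfl rfl (by ring) (by ring) rfl rfl
    qh₀ qh₁ (mul_zero _) (mul_zero _) (by ring) (by ring) rfl rfl rfl)
  have key := congrArg Subtype.val hW₁
  push_cast at key
  have key' : (64 : ExteriorAlgebra ℤ M) * Z
      = 32 * (0 * (h₀ * h₁) - (h₀ + h₁) * S₁ + (h₀ + h₁) * X) + 64 * (W₁ : ExteriorAlgebra ℤ M) :=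
    hcrit.symm.trans key
  have h32 : (32 : ExteriorAlgebra ℤ M) * ((h₀ + h₁) * (X - S₁)) = 32 * (2 * (Z - ↑W₁)) := by
    rw [show (h₀ + h₁) * (X - S₁) = 0 * (h₀ * h₁) - (h₀ + h₁) * S₁ + (h₀ + h₁) * X by noncomm_ring,
      eq_sub_of_add_eq key'.symm]
    simp only [mul_sub, ← mul_assoc]
    norm_num
  refine ⟨Z - ↑W₁, Λ.sub_mem mZ W₁.2, ?_⟩
  have hQ := natCast_mul_cancel x 32 (by norm_num) _ _ (by exact_mod_cast h32)
  subst hh₀ hh₁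
  exact hQ

end Summit.Ventures.HSemireg.LeadingDigitRemainder
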